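import Literature.Combinatorics.Digraph.CompleteDigraphTreeEnumerator
import HarnessLib

/-!
# Levine's Theorem 1.1 exactly as printed: `κ^{vertex}(LG, x) = κ^{edge}(G, x) ∏_v (Σ_{s(e)=v} x_e)^{indeg(v) − 1}`
# for every finite directed graph with no sources (sinks allowed)

Topic `Literature/Combinatorics/Digraph`, namespace `Literature.Combinatorics.Digraph.Multidigraph`.
Lane `lit-hodgefound`, seat p23, generation 46, row g46-#12 of the programme «The spectrum of the arc
digraph and de Bruijn's count `2^{2^{n−1}−n}`». `LineDigraphWeightedArborescences` proved Theorem 1.1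
for digraphs without sources AND without sinks (over a domain: all out-weights `s_v ≠ 0`), and
`CompleteDigraphTreeEnumerator` moved it to every commutative ring of weights, still without sinks. The
printed hypothesis is only «no sources»: a sink `z` (no out-arcs, `s_z = 0`) is allowed. This file
removes the extra hypothesis.

## Source, verbatim

L. Levine, *Sandpile groups and spanning trees of directed line graphs*, J. Combin. Theory Ser. A 118
(2011) 350–364 [Levine2011] (held text `paper:arxiv-0906.2809`, chunk p0003):
«**Theorem 1.1.** Let `G = (V, E)` be a finite directed graph with no sources. Then
`κ^{vertex}(LG, x) = κ^{edge}(G, x) ∏_{v ∈ V} (Σ_{s(e) = v} x_e)^{indeg(v) − 1}`. (1) […] Setting all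
`x_e = 1` yields the product formula `κ(LG) = κ(G) ∏_{v ∈ V} outdeg(v)^{indeg(v) − 1}` (2)».

## The proof formalised here

From the characteristic-polynomial identity of `LineDigraphWeightedArborescences`,
`χ_{L*_w}(X) · ∏_v (X − s_v) = ∏_a (X − s_{tgt a}) · χ_{L_w}(X)` (every multidigraph, every commutative
ring), with `Z` the set of sinks (`k = |Z|`, all `s_z = 0`) and `D` the number of arcs entering sinks:
`∏_v (X − s_v) = X^k ∏_{v ∉ Z} (X − s_v)`, `∏_a (X − s_{tgt a}) = X^D ∏_{tgt a ∉ Z} (X − s_{tgt a})`, and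
`χ = X·f`, `χ* = X·g` (zero row sums) with `f(0) = (−1)^{N−1} κ^{edge}(G, w)`, `g(0) = (−1)^{M−1} κ^{vertex}(G*, w*)`.
Cancelling `X^{k+1}` (a non-zero-divisor of `S[X]`) and evaluating at `0`:
`κ^{vertex}(G*, w*) · ∏_{v ∉ Z} s_v = [D = k] · (∏_{tgt a ∉ Z} s_{tgt a}) · κ^{edge}(G, w)` over every
commutative ring (§1). With no sources `D − k = Σ_{z ∈ Z} (indeg z − 1)`; in `ℤ[x]` the out-weights of
the non-sinks are nonzero, so (1) follows in both cases — if every sink has in-degree `1` the factors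
`s_z^{indeg z − 1} = 1`, otherwise both sides of (1) vanish (§2) — and the identity in `ℤ[x]` specialises to
every commutative ring of weights (§3, `map_arborescencePoly`).

## What is here (theorems only; no definition, no named fact, no instance, no notation)

* §1 `coeff_zero_finsetProd_X_sub_C`; `outWeight_eq_zero_of_outDeg_eq_zero`;
  **`arborescencePoly_lineDigraph_mul_of_sinks`** — the division-free identity above, every commutative
  ring, every finite directed multigraph with an arc.
* §2 **`arborescencePoly_lineDigraph_X_noSources`** — Theorem 1.1 as printed, in the indeterminates
  `x_e` (`MvPolynomial A ℤ`), hypothesis: no sources.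
* §3 **`arborescencePoly_lineDigraph_noSources`** — Theorem 1.1 for all weights in every commutative
  ring, hypothesis: no sources; **`sum_card_arborescencesTo_lineDigraph_noSources`** — (2) as printed,
  `κ(LG) = κ(G) ∏_v outdeg(v)^{indeg(v) − 1}` for every finite directed multigraph without sources.

## References

* [Levine2011] L. Levine, *Sandpile groups and spanning trees of directed line graphs*, J. Combin.
  Theory Ser. A 118 (2011) 350–364, Theorem 1.1 and eq. (2).
* Tree: `Digraph/LineDigraphWeightedArborescences` (`charpoly_wLaplacian_lineDigraph_mul`,
  `charpoly_wLaplacian_arcWeight_coeff_one/zero`, `sum_X_ne_zero`), `Digraph/CompleteDigraphTreeEnumerator`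
  (`map_arborescencePoly`).
-/

namespace Literature.Combinatorics.Digraph

namespace Multidigraph

open Finset Matrix Polynomial
open Literature.Combinatorics.SimpleGraph.WeightedMatrixForest Literature.Combinatorics.Enumerative

variable {V A : Type*} (G : Multidigraph V A) {S : Type*} [CommRing S]

/-! ### §1 The division-free identity with sinks -/

section Sinks

/-- `(∏_{i ∈ s} (X − c_i))(0) = (−1)^{|s|} ∏_{i ∈ s} c_i`. [cite: Levine2011, Thm. 2.1 («`[t] det(t·Id − Δ)`»:
reading off coefficients)] -/
theorem coeff_zero_finsetProd_X_sub_C {ι : Type*} {R : Type*} [CommRing R] (s : Finset ι) (c : ι → R) :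
    (∏ i ∈ s, (X - C (c i))).coeff 0 = (-1) ^ s.card * ∏ i ∈ s, c i := by
  rw [coeff_zero_eq_eval_zero, eval_prod]
  simp only [eval_sub, eval_X, eval_C, zero_sub]
  rw [Finset.prod_neg]

variable [Fintype V] [DecidableEq V] [Fintype A] [DecidableEq A]

omit [Fintype V] [DecidableEq A] in
/-- A sink has out-weight `0` (`Σ_{s(e)=z} x_e` is an empty sum). [cite: Levine2011, Thm. 1.1] -/
theorem outWeight_eq_zero_of_outDeg_eq_zero (w : A → S) {v : V} (hv : G.outDeg v = 0) :
    G.outWeight w v = 0 := by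
  rw [outDeg, Finset.card_eq_zero] at hv
  rw [outWeight, hv, Finset.sum_empty]

/-- **`κ^{vertex}(G*, w*) · ∏_{v ∉ Z} s_v = [D = k] · (∏_{tgt a ∉ Z} s_{tgt a}) · κ^{edge}(G, w)`** for every
finite directed multigraph with an arc and every commutative ring of weights, where `Z` is the set of
sinks (`k = |Z|`) and `D = k + e` the number of arcs entering sinks: the characteristic-polynomial
identity `χ_{L*_w}·∏_v (X − s_v) = ∏_a (X − s_{tgt a})·χ_{L_w}` with the factors `X` of the sinks pulled
out, `X^{k+1}` cancelled, at `X = 0`. [cite: Levine2011, Thm. 1.1 (proof: `χ(t) = χ_1(t) χ_2(t)`,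
`[t] χ`)] -/
theorem arborescencePoly_lineDigraph_mul_of_sinks [Nonempty A] (w : A → S) (e : ℕ)
    (he : (univ.filter fun a => G.outDeg (G.tgt a) = 0).card =
      (univ.filter fun v => G.outDeg v = 0).card + e) :
    G.lineDigraph.arborescencePoly (fun p => w p.1.2) *
        ∏ v ∈ univ.filter (fun v => ¬G.outDeg v = 0), G.outWeight w v =
      if e = 0 then
        (∏ a ∈ univ.filter (fun a => ¬G.outDeg (G.tgt a) = 0), G.outWeight w (G.tgt a)) *
          G.arborescencePoly w
      else 0 := by
  classical
  obtain ⟨a₀⟩ := ‹Nonempty A›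
  haveI : Nonempty V := ⟨G.src a₀⟩
  -- the factors of the sinks are `X`
  have hsinkV : ∀ v ∈ univ.filter (fun v => G.outDeg v = 0),
      (X - C (G.outWeight w v) : S[X]) = X := fun v hv => by
    rw [G.outWeight_eq_zero_of_outDeg_eq_zero w (Finset.mem_filter.1 hv).2, map_zero, sub_zero]
  have hsinkA : ∀ a ∈ univ.filter (fun a => G.outDeg (G.tgt a) = 0),
      (X - C (G.outWeight w (G.tgt a)) : S[X]) = X := fun a ha => by
    rw [G.outWeight_eq_zero_of_outDeg_eq_zero w (Finset.mem_filter.1 ha).2, map_zero, sub_zero]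
  have hsplitV : ∏ v, (X - C (G.outWeight w v)) =
      (X : S[X]) ^ (univ.filter fun v => G.outDeg v = 0).card *
        ∏ v ∈ univ.filter (fun v => ¬G.outDeg v = 0), (X - C (G.outWeight w v)) := by
    rw [← Finset.prod_filter_mul_prod_filter_not univ (fun v => G.outDeg v = 0),
      Finset.prod_congr rfl hsinkV, Finset.prod_const]
  have hsplitA : ∏ a, (X - C (G.outWeight w (G.tgt a))) =
      (X : S[X]) ^ (univ.filter fun a => G.outDeg (G.tgt a) = 0).card *
        ∏ a ∈ univ.filter (fun a => ¬G.outDeg (G.tgt a) = 0), (X - C (G.outWeight w (G.tgt a))) := by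
    rw [← Finset.prod_filter_mul_prod_filter_not univ (fun a => G.outDeg (G.tgt a) = 0),
      Finset.prod_congr rfl hsinkA, Finset.prod_const]
  -- `χ = X·f`, `χ* = X·g`
  obtain ⟨f, hf⟩ : (X : S[X]) ∣ (wLaplacian (G.arcWeight w)).charpoly :=
    X_dvd_iff.2 (G.charpoly_wLaplacian_arcWeight_coeff_zero w)
  obtain ⟨g, hg⟩ : (X : S[X]) ∣ (wLaplacian (G.lineDigraph.arcWeight fun p => w p.1.2)).charpoly :=
    X_dvd_iff.2 (G.lineDigraph.charpoly_wLaplacian_arcWeight_coeff_zero _)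
  have hf0 : f.coeff 0 = (-1) ^ (Fintype.card V - 1) * G.arborescencePoly w := by
    rw [← coeff_X_mul f 0, zero_add, ← hf, charpoly_wLaplacian_arcWeight_coeff_one]
  have hg0 : g.coeff 0 =
      (-1) ^ (Fintype.card A - 1) * G.lineDigraph.arborescencePoly fun p => w p.1.2 := by
    rw [← coeff_X_mul g 0, zero_add, ← hg, charpoly_wLaplacian_arcWeight_coeff_one]
  -- the identity of `LineDigraphWeightedArborescences`, with the factors `X` pulled out
  have key := G.charpoly_wLaplacian_lineDigraph_mul w
  rw [hsplitV, hsplitA, hg, hf, he] at key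
  set k := (univ.filter fun v => G.outDeg v = 0).card with hk
  set PV : S[X] := ∏ v ∈ univ.filter (fun v => ¬G.outDeg v = 0), (X - C (G.outWeight w v)) with hPV
  set PA : S[X] := ∏ a ∈ univ.filter (fun a => ¬G.outDeg (G.tgt a) = 0),
    (X - C (G.outWeight w (G.tgt a))) with hPA
  have key2 : (X : S[X]) ^ (k + 1) * (g * PV) = X ^ (k + 1) * (X ^ e * (PA * f)) := by
    calc (X : S[X]) ^ (k + 1) * (g * PV) = X * g * (X ^ k * PV) := by ring
    _ = X ^ (k + e) * PA * (X * f) := key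
    _ = X ^ (k + 1) * (X ^ e * (PA * f)) := by ring
  have key3 : g * PV = X ^ e * (PA * f) := (isRegular_X_pow (k + 1)).left key2
  -- the constant coefficients
  have hPV0 : PV.coeff 0 = (-1) ^ (univ.filter fun v => ¬G.outDeg v = 0).card *
      ∏ v ∈ univ.filter (fun v => ¬G.outDeg v = 0), G.outWeight w v := by
    rw [hPV, coeff_zero_finsetProd_X_sub_C]
  have hPA0 : PA.coeff 0 = (-1) ^ (univ.filter fun a => ¬G.outDeg (G.tgt a) = 0).card *
      ∏ a ∈ univ.filter (fun a => ¬G.outDeg (G.tgt a) = 0), G.outWeight w (G.tgt a) := by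
    rw [hPA, coeff_zero_finsetProd_X_sub_C]
  have hu : IsUnit ((-1 : S) ^ (Fintype.card A - 1) *
      (-1) ^ (univ.filter fun v => ¬G.outDeg v = 0).card) :=
    ((isUnit_one.neg).pow _).mul ((isUnit_one.neg).pow _)
  have hc := congrArg (fun p : S[X] => p.coeff 0) key3
  rw [mul_coeff_zero, hg0, hPV0, coeff_X_pow_mul'] at hc
  by_cases he0 : e = 0
  · -- `D = k`: compare the constant coefficients, the signs agree
    rw [if_pos he0]
    rw [if_pos (by omega), he0, Nat.sub_zero, mul_coeff_zero, hPA0, hf0] at hc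
    -- bookkeeping of the sign exponents
    have hN := Finset.card_filter_add_card_filter_not (s := (univ : Finset V))
      (fun v => G.outDeg v = 0)
    have hM := Finset.card_filter_add_card_filter_not (s := (univ : Finset A))
      (fun a => G.outDeg (G.tgt a) = 0)
    rw [Finset.card_univ] at hN hM
    have hM1 : 1 ≤ Fintype.card A := Fintype.card_pos
    have hN1 : 1 ≤ Fintype.card V := Fintype.card_pos
    have hexp : (univ.filter fun a => ¬G.outDeg (G.tgt a) = 0).card + (Fintype.card V - 1) =
        (Fintype.card A - 1) + (univ.filter fun v => ¬G.outDeg v = 0).card := by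
      omega
    have hsign : (-1 : S) ^ (univ.filter fun a => ¬G.outDeg (G.tgt a) = 0).card *
        (-1) ^ (Fintype.card V - 1) =
          (-1) ^ (Fintype.card A - 1) * (-1) ^ (univ.filter fun v => ¬G.outDeg v = 0).card := by
      rw [← pow_add, ← pow_add, hexp]
    refine hu.mul_right_injective ?_
    calc (-1 : S) ^ (Fintype.card A - 1) * (-1) ^ (univ.filter fun v => ¬G.outDeg v = 0).card *
          (G.lineDigraph.arborescencePoly (fun p => w p.1.2) *
            ∏ v ∈ univ.filter (fun v => ¬G.outDeg v = 0), G.outWeight w v)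
        = (-1) ^ (Fintype.card A - 1) * G.lineDigraph.arborescencePoly (fun p => w p.1.2) *
            ((-1) ^ (univ.filter fun v => ¬G.outDeg v = 0).card *
              ∏ v ∈ univ.filter (fun v => ¬G.outDeg v = 0), G.outWeight w v) := by ring
      _ = (-1) ^ (univ.filter fun a => ¬G.outDeg (G.tgt a) = 0).card *
            (∏ a ∈ univ.filter (fun a => ¬G.outDeg (G.tgt a) = 0), G.outWeight w (G.tgt a)) *
            ((-1) ^ (Fintype.card V - 1) * G.arborescencePoly w) := hc
      _ = (-1) ^ (univ.filter fun a => ¬G.outDeg (G.tgt a) = 0).card * (-1) ^ (Fintype.card V - 1) *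
            ((∏ a ∈ univ.filter (fun a => ¬G.outDeg (G.tgt a) = 0), G.outWeight w (G.tgt a)) *
              G.arborescencePoly w) := by ring
      _ = (-1 : S) ^ (Fintype.card A - 1) * (-1) ^ (univ.filter fun v => ¬G.outDeg v = 0).card *
            ((∏ a ∈ univ.filter (fun a => ¬G.outDeg (G.tgt a) = 0), G.outWeight w (G.tgt a)) *
              G.arborescencePoly w) := by rw [hsign]
  · -- `D > k`: the left side vanishes
    rw [if_neg he0]
    rw [if_neg (by omega)] at hc
    refine (hu.mul_right_eq_zero).1 ?_
    calc (-1 : S) ^ (Fintype.card A - 1) * (-1) ^ (univ.filter fun v => ¬G.outDeg v = 0).card *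
          (G.lineDigraph.arborescencePoly (fun p => w p.1.2) *
            ∏ v ∈ univ.filter (fun v => ¬G.outDeg v = 0), G.outWeight w v)
        = (-1) ^ (Fintype.card A - 1) * G.lineDigraph.arborescencePoly (fun p => w p.1.2) *
            ((-1) ^ (univ.filter fun v => ¬G.outDeg v = 0).card *
              ∏ v ∈ univ.filter (fun v => ¬G.outDeg v = 0), G.outWeight w v) := by ring
      _ = 0 := hc

end Sinks

/-! ### §2 Theorem 1.1 as printed, in the indeterminates `x_e` -/

section AsPrinted

variable [Fintype V] [DecidableEq V] [Fintype A] [DecidableEq A]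

/-- **Theorem 1.1** («Let `G = (V, E)` be a finite directed graph with no sources. Then
`κ^{vertex}(LG, x) = κ^{edge}(G, x) ∏_{v ∈ V} (Σ_{s(e) = v} x_e)^{indeg(v) − 1}`»), exactly as printed —
sinks allowed — in the indeterminates `x_e` (`MvPolynomial A ℤ`). [cite: Levine2011, Thm. 1.1] -/
theorem arborescencePoly_lineDigraph_X_noSources (hin : ∀ v, 0 < G.inDeg v) :
    G.lineDigraph.arborescencePoly (fun p => (MvPolynomial.X p.1.2 : MvPolynomial A ℤ)) =
      G.arborescencePoly (fun a => MvPolynomial.X a) *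
        ∏ v, (∑ a ∈ G.outArcs v, (MvPolynomial.X a : MvPolynomial A ℤ)) ^ (G.inDeg v - 1) := by
  classical
  cases isEmpty_or_nonempty V with
  | inl h =>
    haveI : IsEmpty A := ⟨fun a => h.false (G.src a)⟩
    simp [arborescencePoly]
  | inr h =>
    obtain ⟨v₀⟩ := h
    obtain ⟨a₀, -⟩ : ∃ a, G.tgt a = v₀ := by
      have := hin v₀
      rw [inDeg, Finset.card_pos] at this
      obtain ⟨a, ha⟩ := this
      exact ⟨a, mem_inArcs.1 ha⟩
    haveI : Nonempty A := ⟨a₀⟩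
    -- abbreviation for the weights
    set x : A → MvPolynomial A ℤ := fun a => MvPolynomial.X a with hx
    rw [show (fun p : {p : A × A // G.tgt p.1 = G.src p.2} => (MvPolynomial.X p.1.2 : MvPolynomial A ℤ))
        = fun p => x p.1.2 from rfl]
    -- `D = Σ_{z ∈ Z} indeg z = k + Σ_{z ∈ Z} (indeg z − 1)`
    have hD : (univ.filter fun a => G.outDeg (G.tgt a) = 0).card =
        ∑ z ∈ univ.filter (fun v => G.outDeg v = 0), G.inDeg z := by
      rw [Finset.card_eq_sum_card_fiberwise (f := G.tgt) (s := univ.filter fun a => G.outDeg (G.tgt a) = 0)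
        (t := univ.filter fun v => G.outDeg v = 0) (fun a ha => by simpa using ha)]
      refine Finset.sum_congr rfl fun z hz => ?_
      rw [inDeg]
      congr 1
      ext a
      simp only [Finset.mem_filter, Finset.mem_univ, true_and, mem_inArcs]
      constructor
      · exact fun h => h.2
      · intro h
        refine ⟨?_, h⟩
        rw [h]
        exact (Finset.mem_filter.1 hz).2
    have he : (univ.filter fun a => G.outDeg (G.tgt a) = 0).card =
        (univ.filter fun v => G.outDeg v = 0).card +
          ∑ z ∈ univ.filter (fun v => G.outDeg v = 0), (G.inDeg z - 1) := by
      rw [hD, Finset.card_eq_sum_ones, ← Finset.sum_add_distrib]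
      exact Finset.sum_congr rfl fun z _ => by have := hin z; omega
    have key := G.arborescencePoly_lineDigraph_mul_of_sinks x _ he
    -- the out-weights of the non-sinks are nonzero sums of indeterminates
    have hprod : ∏ v ∈ univ.filter (fun v => ¬G.outDeg v = 0), G.outWeight x v ≠ 0 := by
      refine Finset.prod_ne_zero_iff.2 fun v hv => ?_
      rw [outWeight, hx]
      exact sum_X_ne_zero (by
        rw [Finset.nonempty_iff_ne_empty, Ne, ← Finset.card_eq_zero]
        exact (Finset.mem_filter.1 hv).2)
    by_cases he0 : ∑ z ∈ univ.filter (fun v => G.outDeg v = 0), (G.inDeg z - 1) = 0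
    · -- every sink has in-degree `1`
      rw [he0, if_pos rfl] at key
      have h1 : ∀ z ∈ univ.filter (fun v => G.outDeg v = 0), G.inDeg z - 1 = 0 :=
        Finset.sum_eq_zero_iff.1 he0
      -- `∏_{tgt a ∉ Z} s_{tgt a} = (∏_{v ∉ Z} s_v^{indeg v − 1}) · ∏_{v ∉ Z} s_v`
      have hprod' : ∏ a ∈ univ.filter (fun a => ¬G.outDeg (G.tgt a) = 0), G.outWeight x (G.tgt a) =
          (∏ v ∈ univ.filter (fun v => ¬G.outDeg v = 0), G.outWeight x v ^ (G.inDeg v - 1)) *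
            ∏ v ∈ univ.filter (fun v => ¬G.outDeg v = 0), G.outWeight x v := by
        rw [← Finset.prod_mul_distrib,
          ← Finset.prod_fiberwise_of_maps_to (s := univ.filter fun a => ¬G.outDeg (G.tgt a) = 0)
            (t := univ.filter fun v => ¬G.outDeg v = 0) (g := G.tgt) (fun a ha => by simpa using ha)]
        refine Finset.prod_congr rfl fun v hv => ?_
        have hset : (univ.filter fun a => ¬G.outDeg (G.tgt a) = 0).filter (fun a => G.tgt a = v) =
            G.inArcs v := by
          ext a
          simp only [Finset.mem_filter, Finset.mem_univ, true_and, mem_inArcs]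
          constructor
          · exact fun h => h.2
          · intro h
            refine ⟨?_, h⟩
            rw [h]
            exact (Finset.mem_filter.1 hv).2
        rw [hset, Finset.prod_congr rfl fun a (ha : a ∈ G.inArcs v) => by rw [mem_inArcs.1 ha],
          Finset.prod_const, ← pow_succ, ← inDeg, Nat.sub_add_cancel (hin v)]
      rw [hprod'] at key
      have key' : G.lineDigraph.arborescencePoly (fun p => x p.1.2) *
          ∏ v ∈ univ.filter (fun v => ¬G.outDeg v = 0), G.outWeight x v =
            G.arborescencePoly x *
              (∏ v ∈ univ.filter (fun v => ¬G.outDeg v = 0), G.outWeight x v ^ (G.inDeg v - 1)) *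
                ∏ v ∈ univ.filter (fun v => ¬G.outDeg v = 0), G.outWeight x v := by
        rw [key]
        ring
      have hmain := mul_right_cancel₀ hprod key'
      -- the factors of the sinks in the printed product are `s_z^0 = 1`
      have hall : ∏ v, G.outWeight x v ^ (G.inDeg v - 1) =
          ∏ v ∈ univ.filter (fun v => ¬G.outDeg v = 0), G.outWeight x v ^ (G.inDeg v - 1) := by
        rw [← Finset.prod_filter_mul_prod_filter_not univ (fun v => G.outDeg v = 0),
          Finset.prod_congr rfl fun z hz => by rw [h1 z hz, pow_zero], Finset.prod_const_one, one_mul]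
      rw [hmain, ← hall]
      rfl
    · -- a sink of in-degree `≥ 2`: both sides vanish
      rw [if_neg he0] at key
      have hκ : G.lineDigraph.arborescencePoly (fun p => x p.1.2) = 0 :=
        (mul_eq_zero.1 key).resolve_right hprod
      obtain ⟨z, hz, hz2⟩ : ∃ z ∈ univ.filter (fun v => G.outDeg v = 0), G.inDeg z - 1 ≠ 0 := by
        by_contra hne
        push Not at hne
        exact he0 (Finset.sum_eq_zero hne)
      have hz0 : G.outArcs z = ∅ := by
        have := (Finset.mem_filter.1 hz).2
        rwa [outDeg, Finset.card_eq_zero] at this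
      rw [hκ, eq_comm]
      exact mul_eq_zero_of_right _ (Finset.prod_eq_zero (Finset.mem_univ z)
        (by rw [hz0, Finset.sum_empty, zero_pow hz2]))

end AsPrinted

/-! ### §3 Every commutative ring of weights; all `x_e = 1` -/

section AllRings

variable [Fintype V] [DecidableEq V] [Fintype A] [DecidableEq A]

/-- **Theorem 1.1 for all weights in every commutative ring, hypothesis «no sources» only**:
`κ^{vertex}(G*, w*) = κ^{edge}(G, w) · ∏_v s_v^{indeg(v) − 1}` for every `w : A → S`.
[cite: Levine2011, Thm. 1.1] -/
theorem arborescencePoly_lineDigraph_noSources (w : A → S) (hin : ∀ v, 0 < G.inDeg v) :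
    G.lineDigraph.arborescencePoly (fun p => w p.1.2) =
      G.arborescencePoly w * ∏ v, G.outWeight w v ^ (G.inDeg v - 1) := by
  have h := congrArg (MvPolynomial.aeval w : MvPolynomial A ℤ →ₐ[ℤ] S)
    (G.arborescencePoly_lineDigraph_X_noSources hin)
  rw [map_mul, map_prod, map_arborescencePoly, map_arborescencePoly] at h
  simp_rw [map_pow, map_sum, MvPolynomial.aeval_X] at h
  exact h

/-- **(2) as printed** («Setting all `x_e = 1` yields the product formula
`κ(LG) = κ(G) ∏_{v ∈ V} outdeg(v)^{indeg(v) − 1}`»): for every finite directed multigraph without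
sources — sinks allowed — with `κ(·) = Σ_roots t⁻(·, root)`. [cite: Levine2011, eq. (2); Knuth1967,
Theorem (5)] -/
theorem sum_card_arborescencesTo_lineDigraph_noSources (hin : ∀ v, 0 < G.inDeg v) :
    ∑ a, (G.lineDigraph.arborescencesTo a).card =
      (∑ v, (G.arborescencesTo v).card) * ∏ v, G.outDeg v ^ (G.inDeg v - 1) := by
  have h := G.arborescencePoly_lineDigraph_noSources (fun _ => (1 : ℤ)) hin
  rw [arborescencePoly_one, arborescencePoly_one] at h
  simp_rw [outWeight_one] at h
  exact_mod_cast h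

end AllRings

end Multidigraph

end Literature.Combinatorics.Digraph
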